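import Summits.QuantumAdvantage.QuantumAdvantage.Theorems.CubicForrelationNearExactIsExactSixteenTypeO
import Summits.QuantumAdvantage.QuantumAdvantage.Theorems.CubicForrelationNearExactIsExactMinWeightFlat

/-!
# Crux `CubicForrelation.NearExactIsExact` (stmt-QuantumAdvantage-14043) — n = 16 two-sided analysis, level 8: preparatory lemmas

Certificate seat `b2b-cforr-cert` (gen 4).  HONEST FRAMING: elementary lemmas feeding a theorem about cubic Boolean functions on 16 bits (the
finite slice `n = 16` of the crux) — NOT summit progress.

* `se_pt_six` (general `n`): the points of a parametrised 6-flat `x ⊕ ⟨d₁,d₂,d₃,d₄,c,c'⟩` as iterated `⊕`.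
* `se_dirs4`: four directions TRANSVERSAL to a set `V₀ ⊂ 𝔽₂¹⁶` with `#V₀ ≤ 4096`: all fifteen non-trivial `⊕`-combinations avoid `V₀`
  (greedy choice; `8·4096 < 2¹⁶`).
* `se_budget8`: the two-sided budget at level 8 on 16 bits, `W_g = 256w`: `Σ_x (w − (−1)^f)² = 2¹⁷(1 − Φ)`.
Used by `…SixteenLevelEight.lean` (the level-8 boundary configuration `Φ = 31/32` is not realizable).

References: S. Aaronson, A. Ambainis, SIAM J. Comput. 47 (2018) §1.1.1; R. O'Donnell (2014) §3.3.  Everything below is proved from Mathlib and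
the tree; axioms are the standard three.
-/

set_option linter.dupNamespace false -- D-0017: single-problem summit ⇒ `QuantumAdvantage.QuantumAdvantage` by design

noncomputable section

namespace Summit.QuantumAdvantage.QuantumAdvantage.Theorems.CubicForrelation.NearExactIsExact

open Finset
open Literature.Computability.QuantumComplexity
open Literature.Computability.QuantumComplexity.BuzetChailloux (bxor zeroVec bxor_bxor_cancel_left bxor_zeroVec zeroVec_bxor bxor_comm
  signOf_sq)
open Literature.Computability.QuantumComplexity.DerivativeWalsh (W sum_W_sq)

variable {n : ℕ}

/-- The points of the parametrised 6-flat `x ⊕ ⟨d₁,d₂,d₃,d₄,a,b⟩` as iterated `bxor`s: `x ⊕ ε₅b ⊕ ε₄a ⊕ ε₃d₄ ⊕ ε₂d₃ ⊕ ε₁d₂ ⊕ ε₀d₁`.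
[folklore] -/
theorem se_pt_six (x d₁ d₂ d₃ d₄ a b : Fin n → Bool) (e₀ e₁ e₂ e₃ e₄ e₅ : Bool) (t : Fin 0 → Bool) (ta : Fin 0 → Fin n → Bool) :
    (fun j => x j ^^ decide (Odd #(univ.filter fun i : Fin 6 =>
      (Fin.cons e₀ (Fin.cons e₁ (Fin.cons e₂ (Fin.cons e₃ (Fin.cons e₄ (Fin.cons e₅ t : Fin 1 → Bool) : Fin 2 → Bool) : Fin 3 → Bool)
        : Fin 4 → Bool) : Fin 5 → Bool) : Fin 6 → Bool) i &&
      (Fin.cons d₁ (Fin.cons d₂ (Fin.cons d₃ (Fin.cons d₄ (Fin.cons a (Fin.cons b ta : Fin 1 → Fin n → Bool) : Fin 2 → Fin n → Bool)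
        : Fin 3 → Fin n → Bool) : Fin 4 → Fin n → Bool) : Fin 5 → Fin n → Bool) : Fin 6 → Fin n → Bool) i j))) =
      bxor (bxor (bxor (bxor (bxor (bxor x (fun j => e₅ && b j)) (fun j => e₄ && a j)) (fun j => e₃ && d₄ j)) (fun j => e₂ && d₃ j))
        (fun j => e₁ && d₂ j)) (fun j => e₀ && d₁ j) := by
  have h1 := erm_flatPt_cons x d₁ (Fin.cons d₂ (Fin.cons d₃ (Fin.cons d₄ (Fin.cons a (Fin.cons b ta : Fin 1 → Fin n → Bool)
      : Fin 2 → Fin n → Bool) : Fin 3 → Fin n → Bool) : Fin 4 → Fin n → Bool) : Fin 5 → Fin n → Bool) e₀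
    (Fin.cons e₁ (Fin.cons e₂ (Fin.cons e₃ (Fin.cons e₄ (Fin.cons e₅ t : Fin 1 → Bool) : Fin 2 → Bool) : Fin 3 → Bool) : Fin 4 → Bool)
      : Fin 5 → Bool)
  have h2 := erm_flatPt_cons x d₂ (Fin.cons d₃ (Fin.cons d₄ (Fin.cons a (Fin.cons b ta : Fin 1 → Fin n → Bool) : Fin 2 → Fin n → Bool)
      : Fin 3 → Fin n → Bool) : Fin 4 → Fin n → Bool) e₁
    (Fin.cons e₂ (Fin.cons e₃ (Fin.cons e₄ (Fin.cons e₅ t : Fin 1 → Bool) : Fin 2 → Bool) : Fin 3 → Bool) : Fin 4 → Bool)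
  have h3 := erm_flatPt_cons x d₃ (Fin.cons d₄ (Fin.cons a (Fin.cons b ta : Fin 1 → Fin n → Bool) : Fin 2 → Fin n → Bool)
      : Fin 3 → Fin n → Bool) e₂ (Fin.cons e₃ (Fin.cons e₄ (Fin.cons e₅ t : Fin 1 → Bool) : Fin 2 → Bool) : Fin 3 → Bool)
  have h4 := erm_flatPt_cons x d₄ (Fin.cons a (Fin.cons b ta : Fin 1 → Fin n → Bool) : Fin 2 → Fin n → Bool) e₃
    (Fin.cons e₄ (Fin.cons e₅ t : Fin 1 → Bool) : Fin 2 → Bool)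
  have h5 := erm_flatPt_cons x a (Fin.cons b ta : Fin 1 → Fin n → Bool) e₄ (Fin.cons e₅ t : Fin 1 → Bool)
  have h6 := erm_flatPt_cons x b ta e₅ t
  have h7 := tep_flatPt_nil x ta t
  rw [h1]
  funext j
  rw [congrFun h2 j, congrFun h3 j, congrFun h4 j, congrFun h5 j, congrFun h6 j, congrFun h7 j]

/-- A vector outside a union of at most eight translates of a set of size `≤ 4096` in `𝔽₂¹⁶`. [folklore] -/
theorem se_avoid (V₀ : Finset (Fin (8 + 8) → Bool)) (hcard : #V₀ ≤ 4096) (ts : List (Fin (8 + 8) → Bool)) (hts : ts.length ≤ 8) :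
    ∃ d : Fin (8 + 8) → Bool, ∀ t ∈ ts, bxor t d ∉ V₀ := by
  classical
  have huniv : #(univ : Finset (Fin (8 + 8) → Bool)) = 65536 := by simp
  -- the union of the translates `V₀.image (bxor t)` has at most `8 · 4096 < 65536` elements
  have hU : #(ts.toFinset.biUnion fun t => V₀.image (bxor t)) < #(univ : Finset (Fin (8 + 8) → Bool)) := by
    rw [huniv]
    calc #(ts.toFinset.biUnion fun t => V₀.image (bxor t)) ≤ ∑ t ∈ ts.toFinset, #(V₀.image (bxor t)) := card_biUnion_le
      _ ≤ ∑ t ∈ ts.toFinset, 4096 := sum_le_sum fun t _ => card_image_le.trans hcard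
      _ = 4096 * #ts.toFinset := by rw [sum_const, smul_eq_mul, mul_comm]
      _ ≤ 4096 * 8 := Nat.mul_le_mul_left _ ((List.toFinset_card_le ts).trans hts)
      _ < 65536 := by norm_num
  obtain ⟨d, -, hd⟩ := exists_mem_notMem_of_card_lt_card hU
  refine ⟨d, fun t ht hmem => hd ?_⟩
  rw [mem_biUnion]
  exact ⟨t, List.mem_toFinset.2 ht, mem_image.2 ⟨bxor t d, hmem, bxor_bxor_cancel_left t d⟩⟩

/-- **Four transversal directions.** For `V₀ ⊂ 𝔽₂¹⁶` with `#V₀ ≤ 4096` there are `d₁, d₂, d₃, d₄` all of whose fifteen non-trivial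
`⊕`-combinations lie outside `V₀`. [folklore] -/
theorem se_dirs4 (V₀ : Finset (Fin (8 + 8) → Bool)) (hcard : #V₀ ≤ 4096) :
    ∃ d₁ d₂ d₃ d₄ : Fin (8 + 8) → Bool,
      d₄ ∉ V₀ ∧
      d₃ ∉ V₀ ∧
      d₂ ∉ V₀ ∧
      d₁ ∉ V₀ ∧
      bxor d₄ d₃ ∉ V₀ ∧
      bxor d₄ d₂ ∉ V₀ ∧
      bxor d₄ d₁ ∉ V₀ ∧
      bxor d₃ d₂ ∉ V₀ ∧
      bxor d₃ d₁ ∉ V₀ ∧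
      bxor d₂ d₁ ∉ V₀ ∧
      bxor d₄ (bxor d₃ d₂) ∉ V₀ ∧
      bxor d₄ (bxor d₃ d₁) ∉ V₀ ∧
      bxor d₄ (bxor d₂ d₁) ∉ V₀ ∧
      bxor d₃ (bxor d₂ d₁) ∉ V₀ ∧
      bxor d₄ (bxor d₃ (bxor d₂ d₁)) ∉ V₀ := by
  have hz : ∀ d : Fin (8 + 8) → Bool, bxor zeroVec d = d := zeroVec_bxor
  obtain ⟨d₁, hd₁⟩ := se_avoid V₀ hcard [zeroVec] (by simp)
  have e₁ : d₁ ∉ V₀ := by simpa only [hz] using hd₁ zeroVec (by simp)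
  obtain ⟨d₂, hd₂⟩ := se_avoid V₀ hcard [zeroVec, d₁] (by simp)
  have e₂ : d₂ ∉ V₀ := by simpa only [hz] using hd₂ zeroVec (by simp)
  have e₂₁ : bxor d₁ d₂ ∉ V₀ := hd₂ d₁ (by simp)
  obtain ⟨d₃, hd₃⟩ := se_avoid V₀ hcard [zeroVec, d₁, d₂, bxor d₂ d₁] (by simp)
  have e₃ : d₃ ∉ V₀ := by simpa only [hz] using hd₃ zeroVec (by simp)
  have e₃₁ : bxor d₁ d₃ ∉ V₀ := hd₃ d₁ (by simp)
  have e₃₂ : bxor d₂ d₃ ∉ V₀ := hd₃ d₂ (by simp)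
  have e₃₂₁ : bxor (bxor d₂ d₁) d₃ ∉ V₀ := hd₃ (bxor d₂ d₁) (by simp)
  obtain ⟨d₄, hd₄⟩ := se_avoid V₀ hcard [zeroVec, d₁, d₂, bxor d₂ d₁, d₃, bxor d₃ d₁, bxor d₃ d₂, bxor (bxor d₃ d₂) d₁] (by simp)
  have e₄ : d₄ ∉ V₀ := by simpa only [hz] using hd₄ zeroVec (by simp)
  have e₄₁ : bxor d₁ d₄ ∉ V₀ := hd₄ d₁ (by simp)
  have e₄₂ : bxor d₂ d₄ ∉ V₀ := hd₄ d₂ (by simp)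
  have e₄₂₁ : bxor (bxor d₂ d₁) d₄ ∉ V₀ := hd₄ (bxor d₂ d₁) (by simp)
  have e₄₃ : bxor d₃ d₄ ∉ V₀ := hd₄ d₃ (by simp)
  have e₄₃₁ : bxor (bxor d₃ d₁) d₄ ∉ V₀ := hd₄ (bxor d₃ d₁) (by simp)
  have e₄₃₂ : bxor (bxor d₃ d₂) d₄ ∉ V₀ := hd₄ (bxor d₃ d₂) (by simp)
  have e₄₃₂₁ : bxor (bxor (bxor d₃ d₂) d₁) d₄ ∉ V₀ := hd₄ (bxor (bxor d₃ d₂) d₁) (by simp)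
  refine ⟨d₁, d₂, d₃, d₄, ?_, ?_, ?_, ?_, ?_, ?_, ?_, ?_, ?_, ?_, ?_, ?_, ?_, ?_, ?_⟩
  · exact e₄
  · exact e₃
  · exact e₂
  · exact e₁
  · have h : bxor d₄ d₃ = bxor d₃ d₄ := by
      funext i
      show (d₄ i ^^ d₃ i) = (d₃ i ^^ d₄ i)
      cases d₁ i <;> cases d₂ i <;> cases d₃ i <;> cases d₄ i <;> rfl
    rw [h]; exact e₄₃
  · have h : bxor d₄ d₂ = bxor d₂ d₄ := by
      funext i
      show (d₄ i ^^ d₂ i) = (d₂ i ^^ d₄ i)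
      cases d₁ i <;> cases d₂ i <;> cases d₃ i <;> cases d₄ i <;> rfl
    rw [h]; exact e₄₂
  · have h : bxor d₄ d₁ = bxor d₁ d₄ := by
      funext i
      show (d₄ i ^^ d₁ i) = (d₁ i ^^ d₄ i)
      cases d₁ i <;> cases d₂ i <;> cases d₃ i <;> cases d₄ i <;> rfl
    rw [h]; exact e₄₁
  · have h : bxor d₃ d₂ = bxor d₂ d₃ := by
      funext i
      show (d₃ i ^^ d₂ i) = (d₂ i ^^ d₃ i)
      cases d₁ i <;> cases d₂ i <;> cases d₃ i <;> cases d₄ i <;> rfl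
    rw [h]; exact e₃₂
  · have h : bxor d₃ d₁ = bxor d₁ d₃ := by
      funext i
      show (d₃ i ^^ d₁ i) = (d₁ i ^^ d₃ i)
      cases d₁ i <;> cases d₂ i <;> cases d₃ i <;> cases d₄ i <;> rfl
    rw [h]; exact e₃₁
  · have h : bxor d₂ d₁ = bxor d₁ d₂ := by
      funext i
      show (d₂ i ^^ d₁ i) = (d₁ i ^^ d₂ i)
      cases d₁ i <;> cases d₂ i <;> cases d₃ i <;> cases d₄ i <;> rfl
    rw [h]; exact e₂₁
  · have h : bxor d₄ (bxor d₃ d₂) = bxor (bxor d₃ d₂) d₄ := by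
      funext i
      show (d₄ i ^^ (d₃ i ^^ d₂ i)) = ((d₃ i ^^ d₂ i) ^^ d₄ i)
      cases d₁ i <;> cases d₂ i <;> cases d₃ i <;> cases d₄ i <;> rfl
    rw [h]; exact e₄₃₂
  · have h : bxor d₄ (bxor d₃ d₁) = bxor (bxor d₃ d₁) d₄ := by
      funext i
      show (d₄ i ^^ (d₃ i ^^ d₁ i)) = ((d₃ i ^^ d₁ i) ^^ d₄ i)
      cases d₁ i <;> cases d₂ i <;> cases d₃ i <;> cases d₄ i <;> rfl
    rw [h]; exact e₄₃₁
  · have h : bxor d₄ (bxor d₂ d₁) = bxor (bxor d₂ d₁) d₄ := by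
      funext i
      show (d₄ i ^^ (d₂ i ^^ d₁ i)) = ((d₂ i ^^ d₁ i) ^^ d₄ i)
      cases d₁ i <;> cases d₂ i <;> cases d₃ i <;> cases d₄ i <;> rfl
    rw [h]; exact e₄₂₁
  · have h : bxor d₃ (bxor d₂ d₁) = bxor (bxor d₂ d₁) d₃ := by
      funext i
      show (d₃ i ^^ (d₂ i ^^ d₁ i)) = ((d₂ i ^^ d₁ i) ^^ d₃ i)
      cases d₁ i <;> cases d₂ i <;> cases d₃ i <;> cases d₄ i <;> rfl
    rw [h]; exact e₃₂₁
  · have h : bxor d₄ (bxor d₃ (bxor d₂ d₁)) = bxor (bxor (bxor d₃ d₂) d₁) d₄ := by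
      funext i
      show (d₄ i ^^ (d₃ i ^^ (d₂ i ^^ d₁ i))) = (((d₃ i ^^ d₂ i) ^^ d₁ i) ^^ d₄ i)
      cases d₁ i <;> cases d₂ i <;> cases d₃ i <;> cases d₄ i <;> rfl
    rw [h]; exact e₄₃₂₁

/-- Parseval at level 8 and the **two-sided budget at level 8 on 16 bits**: with `W_g = 256w` and `s = (−1)^f`,
`Σ_x (w − s)² = 2¹⁷·(1 − Φ(f,g))`. [this work] -/
theorem se_budget8 (f g : (Fin (8 + 8) → Bool) → Bool) (w : (Fin (8 + 8) → Bool) → ℤ)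
    (hw : ∀ x, W (fun y => signOf (g y)) x = (2 : ℝ) ^ 8 * (w x : ℝ)) :
    ((∑ x, (w x - sZ (f x)) ^ 2 : ℤ) : ℝ) = (2 : ℝ) ^ 17 * (1 - forrelation f g) := by
  have hP := st_parseval16 g
  have hΦ := vg_two_pow_mul_forrelation f g
  have e : ∀ x : Fin (8 + 8) → Bool, ((w x : ℝ) - (sZ (f x) : ℝ)) ^ 2 =
      W (fun y => signOf (g y)) x ^ 2 / 65536 - signOf (f x) * W (fun y => signOf (g y)) x / 128 + 1 := by
    intro x
    have hux : (w x : ℝ) = W (fun y => signOf (g y)) x / 256 := by rw [hw x]; ring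
    have hs2 : signOf (f x) ^ 2 = 1 := signOf_sq _
    rw [tp_sZ_cast, hux]
    nlinarith [hs2]
  push_cast
  rw [sum_congr rfl fun x _ => e x, sum_add_distrib, sum_sub_distrib, ← sum_div, ← sum_div, hP, ← hΦ, sum_const,
    card_univ, Fintype.card_fun, Fintype.card_bool, Fintype.card_fin]
  norm_num
  ring

end Summit.QuantumAdvantage.QuantumAdvantage.Theorems.CubicForrelation.NearExactIsExact

end
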